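import Summits.BirchSwinnertonDyer.BirchSwinnertonDyer.Theorems.ByReductionTypeAtTwoSupersingularFlatBlindTwistedExactControl
import Mathlib.Data.Fintype.Lattice
import HarnessLib

/-!
# Route `ByReductionTypeAtTwo` (rung K4), crux `SupersingularRankZeroAtTwo` (item stmt-BirchSwinnertonDyer-19097), line
# `odd_blind_package` slot 5 (CDC `OddBlindPackage.FlatBlindControlCardAtTwo`): the LEVEL-`∞` PASSAGE for HT-C1 —
# a FINITE `T = Sel^•(E/K_∞)[γ+1]` equals its `p^J`-torsion for `J ≫ 0`, so `#T = #H¹_{𝓕^•ex_J}(K, E[p^J](χ_{−1}))`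
# (cell `bsd-2adic`, seat `t42` GEN 39, bonus to hand h3; LEAD ss-1 GEN 20 `HOME/ss/gen20/HAND-TARGETS-CDC.md` §1 steps 1–2;
# director-bsd (758) «step 3 level-∞ passage `T = T[2^J]` + exact-control limit»)

HONEST FRAMING: THEOREMS ONLY (no definition, no named fact, no `sorry`, no instance); elementary group theory on top of
`…FlatBlindTwistedExactControl` (p812879); a helper (`--supports stmt-BirchSwinnertonDyer-19097`): it does NOT prove CDC, CDF_glob,
CDF± or the crux; the finiteness of `T` is a HYPOTHESIS here (on the line it is CDF_glob, `OddBlindLocal.flatBlindControlOfLocalAtTwo`,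
p812310); nothing booked; BSD is proved for no curve by any of this. bears_on: K4 (19097).

## What is proved

§1 (any `K`, `p`, `κ`, Sprung datum at `v`, `γ`). `exists_pow_smul_eq_zero_endInvariants`: every element of
`T = endInvariants (conjSharpFlatSelmerInfty … γ + 1)` is killed by a power of `p` (`exists_pow_smul_subgroupH1_ker_eq_zero`);
`exists_torsionBy_endInvariants_eq_top_of_finite`: if `T` is finite then `T[p^J] = ⊤` for all `J ≥ J₀` (`J₀` = the largest exponent,
`Finite.exists_max`), hence `natCard_torsionBy_endInvariants_eq_of_finite`: `#T[p^J] = #T` for `J ≥ J₀`.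

§2 (`u = −1`, `E(K)[p] = 0`). ★ `exists_natCard_endInvariants_eq_natCard_selmerGroup_of_finite`: for a family of structures `𝓕 J`
that are place by place the EXACT ones, `T` finite ⟹ `∃ J₀, ∀ J ≥ J₀, #T = #H¹_{𝓕 J}(K, E[p^J](χ_{−1}))`
(`natCard_torsionBy_endInvariants_eq_natCard_selmerGroup`, p812879).

§3 (`K = ℚ`, `p = 2`, `GoodSS W 2`). ★ `exists_natCard_endInvariants_eq_natCard_selmerGroup_of_finite_two`: the same for the LEAD's
`ℚ`-literal structure of hand h3 — CDC road steps 1–2 in one line: `Finite T ⟹ ∃ J₀, ∀ J ≥ J₀, #T = #H¹_{𝓕♭ex_J}(ℚ, E[2^J](ψ₂))`.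

References: [GreenbergLNM1716] §4 pp. 107, 122–124; [Sprung2012] Def. 7.11 (p. 1503); [SerreGaloisCohomology1997] I §2.2.
-/

set_option autoImplicit false
set_option linter.dupNamespace false

noncomputable section

open scoped Classical NumberField AddSubgroup

namespace Summit.BirchSwinnertonDyer.BirchSwinnertonDyer.Theorems

namespace OddBlindTwist

open NumberField IsDedekindDomain Field WeierstrassCurve Literature.NumberTheory.EllipticCurves
  Literature.NumberTheory.EllipticCurves.IwasawaDual Literature.NumberTheory.GaloisRepresentations
  Literature.NumberTheory.GaloisCohomology ZpExtension Literature.NumberTheory.EllipticCurves.Kobayashi2003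
  Literature.NumberTheory.EllipticCurves.Sprung2017 Literature.NumberTheory.EllipticCurves.Sprung2012
  Literature.NumberTheory.EllipticCurves.Rank1Residual
open Literature.NumberTheory.GaloisRepresentations.DiscreteGaloisModule (SelmerStructure)

/-! ## §1 `T = Sel^•(E/K_∞)[γ+1]` is `p`-primary; if finite, `T = T[p^J]` for `J ≫ 0` -/

section Primary

variable {K : Type} [Field K] [NumberField K] (W : WeierstrassCurve K) (p : ℕ) [Fact p.Prime]
  (κ : ZpExtension K p) (v : HeightOneSpectrum (𝓞 K)) (ap : ℤ) (g : absoluteGaloisGroup (v.adicCompletion K))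
  (c : ℕ → localPoints W (v.adicCompletion K)) (col : Chroma) (γ : absoluteGaloisGroup K)

/-- **`T = Sel^•(E/K_∞)[γ+1]` is `p`-primary**: every element of `endInvariants (conjSharpFlatSelmerInfty … γ + 1)` is killed by
some `p^k` — it is a class of `H¹(K_∞, E[p^∞])` (`exists_pow_smul_subgroupH1_ker_eq_zero`). [cite: SerreGaloisCohomology1997, I §2.2]
[cite: Sprung2012, Def. 7.11 (p. 1503)] -/
theorem exists_pow_smul_eq_zero_endInvariants
    (s : endInvariants (conjSharpFlatSelmerInfty W κ (closureEmb (K := K) (v.adicCompletion K)) ap g c col γ + 1)) :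
    ∃ k : ℕ, p ^ k • s = 0 := by
  obtain ⟨k, hk⟩ := W.exists_pow_smul_subgroupH1_ker_eq_zero κ
    (((s : endInvariants (conjSharpFlatSelmerInfty W κ (closureEmb (K := K) (v.adicCompletion K)) ap g c col γ + 1)) :
      sharpFlatSelmerInfty W κ (closureEmb (K := K) (v.adicCompletion K)) ap g c col) : W.subgroupH1 p κ.kerSubgroup)
  refine ⟨k, Subtype.ext (Subtype.ext ?_)⟩
  rw [AddSubgroupClass.coe_nsmul, AddSubgroupClass.coe_nsmul]
  exact hk

/-- **If `T` is finite then `T[p^J] = T` for all large `J`**: `T` is `p`-primary (`exists_pow_smul_eq_zero_endInvariants`) and a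
finite set of exponents has a maximum `J₀` (`Finite.exists_max`); for `J ≥ J₀`, `p^J = p^{J−k} · p^k` kills every element.
[cite: SerreGaloisCohomology1997, I §2.2] [cite: GreenbergLNM1716, §4 p. 124] -/
theorem exists_torsionBy_endInvariants_eq_top_of_finite
    [Finite (endInvariants (conjSharpFlatSelmerInfty W κ (closureEmb (K := K) (v.adicCompletion K)) ap g c col γ + 1))] :
    ∃ J₀ : ℕ, ∀ J : ℕ, J₀ ≤ J →
      (endInvariants
        (conjSharpFlatSelmerInfty W κ (closureEmb (K := K) (v.adicCompletion K)) ap g c col γ + 1))[((p ^ J : ℕ) : ℤ)] = ⊤ := by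
  choose k hk using exists_pow_smul_eq_zero_endInvariants W p κ v ap g c col γ
  obtain ⟨s₀, hs₀⟩ := Finite.exists_max k
  refine ⟨k s₀, fun J hJ ↦ ?_⟩
  rw [eq_top_iff]
  intro s _
  rw [AddSubgroup.torsionBy.nsmul_iff]
  obtain ⟨d, hd⟩ := Nat.exists_eq_add_of_le ((hs₀ s).trans hJ)
  rw [hd, pow_add, mul_comm, mul_smul, hk s, smul_zero]

/-- **Hence `#T[p^J] = #T` for all large `J`** when `T` is finite. [cite: GreenbergLNM1716, §4 p. 124] -/
theorem exists_natCard_torsionBy_endInvariants_eq_of_finite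
    [Finite (endInvariants (conjSharpFlatSelmerInfty W κ (closureEmb (K := K) (v.adicCompletion K)) ap g c col γ + 1))] :
    ∃ J₀ : ℕ, ∀ J : ℕ, J₀ ≤ J →
      Nat.card ((endInvariants
        (conjSharpFlatSelmerInfty W κ (closureEmb (K := K) (v.adicCompletion K)) ap g c col γ + 1))[((p ^ J : ℕ) : ℤ)]) =
      Nat.card (endInvariants (conjSharpFlatSelmerInfty W κ (closureEmb (K := K) (v.adicCompletion K)) ap g c col γ + 1)) := by
  obtain ⟨J₀, hJ₀⟩ := exists_torsionBy_endInvariants_eq_top_of_finite W p κ v ap g c col γ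
  refine ⟨J₀, fun J hJ ↦ ?_⟩
  rw [hJ₀ J hJ, AddSubgroup.card_top]

end Primary

/-! ## §2 `u = −1`: the exact-control LIMIT `#T = #H¹_{𝓕^•ex_J}` for `J ≫ 0` -/

section Limit

variable {K : Type} [Field K] [NumberField K] (W : WeierstrassCurve K) [W.IsElliptic] (p : ℕ) [Fact p.Prime]
  (κ : ZpExtension K p) (v : HeightOneSpectrum (𝓞 K)) (ap : ℤ) (g : absoluteGaloisGroup (v.adicCompletion K))
  (c : ℕ → localPoints W (v.adicCompletion K)) (col : Chroma) (hu1 : (p : ℤ) ∣ (-1 : ℤ) - 1)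
  (𝓕 : ∀ J : ℕ, SelmerStructure (W.twistedTorsionGaloisModule p κ J (-1) hu1))

/-- ★ **EXACT CONTROL IN THE LIMIT (`u = −1`, any `K`, `p`, `κ`, `γ`, `E(K)[p] = 0`).** For a family `𝓕 J` of Selmer structures on
`E[p^J](χ_{−1})` that are place by place the EXACT ones (`hinl`, `hinr`): if `T = Sel^•(E/K_∞)[γ+1]` is FINITE then for all large `J`,
`#T = #H¹_{𝓕 J}(K, E[p^J](χ_{−1}))` — `T = T[p^J]` (`exists_natCard_torsionBy_endInvariants_eq_of_finite`) and exact control at level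
`J` (`natCard_torsionBy_endInvariants_eq_natCard_selmerGroup`, p812879). [cite: GreenbergLNM1716, §4 pp. 107, 122–124]
[cite: Sprung2012, Def. 7.11 (p. 1503)] -/
theorem exists_natCard_endInvariants_eq_natCard_selmerGroup_of_finite
    (hinl : ∀ (J : ℕ) (w : InfinitePlace K), 𝓕 J (Sum.inl w) = (W.twistedTorsionToLocalH1 p κ J (-1) hu1 w.Completion).ker)
    (hinr : ∀ (J : ℕ) (v' : HeightOneSpectrum (𝓞 K)), 𝓕 J (Sum.inr v') = W.twistedSharpFlatLocalFamily p κ J (-1) hu1 v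
      (localTowerPointsOfEmb κ (closureEmb (K := K) (v.adicCompletion K)) W)
      (colemanKer κ (closureEmb (K := K) (v.adicCompletion K)) W ap g c col) v')
    (hK : ∀ P : W.toAffine.Point, p • P = 0 → P = 0) {γ : absoluteGaloisGroup K} (hγ : κ.IsTopGenerator γ)
    [Finite (endInvariants (conjSharpFlatSelmerInfty W κ (closureEmb (K := K) (v.adicCompletion K)) ap g c col γ + 1))] :
    ∃ J₀ : ℕ, ∀ J : ℕ, J₀ ≤ J →
      Nat.card (endInvariants (conjSharpFlatSelmerInfty W κ (closureEmb (K := K) (v.adicCompletion K)) ap g c col γ + 1)) =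
      Nat.card (𝓕 J).selmerGroup := by
  obtain ⟨J₀, hJ₀⟩ := exists_natCard_torsionBy_endInvariants_eq_of_finite W p κ v ap g c col γ
  refine ⟨J₀, fun J hJ ↦ ?_⟩
  rw [← hJ₀ J hJ]
  exact natCard_torsionBy_endInvariants_eq_natCard_selmerGroup W p κ J v ap g c col hu1 (𝓕 J) (hinl J) (hinr J) hK hγ

end Limit

/-! ## §3 The ss line at `p = 2`, `ψ₂ = χ_{−1}`: the limit form of hand h3 for the LEAD's `ℚ`-literal structure -/

section Two

/-- ★ **HT-C1 in the limit (CDC road steps 1–2).** `W/ℚ` with `GoodSS W 2`, the cyclotomic `κ` with topological generator `γ`, `v ∋ 2`,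
Sprung's local data `(a₂, g, c)`, colour ♭: IF `T = Sel♭(E/ℚ_∞)[γ+1]` is finite (on the line: CDF_glob, `OddBlindLocal.flatBlindControlOfLocalAtTwo`)
THEN for all large `J`, `#T = #H¹_{𝓕♭ex_J}(ℚ, E[2^J](ψ₂))` for the EXACT structure of hand h3 (Kummer kernel at every place `≠ v` incl. `∞`,
Sprung's ♭ condition at `v`). The binders `hκ`, `hv`, `[W.IsGloballyMinimal]` are carried to match the hand (idle). HONEST FRAMING: a helper
(`--supports` 19097); CDC is NOT claimed; BSD is proved for no curve. [cite: GreenbergLNM1716, §4 pp. 107, 122–124] [cite: Sprung2012, Def. 7.11 (p. 1503)] -/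
theorem exists_natCard_endInvariants_eq_natCard_selmerGroup_of_finite_two (W : WeierstrassCurve ℚ) [W.IsElliptic]
    [W.IsGloballyMinimal] (hss : GoodSS W 2) {κ : ZpExtension ℚ 2} (hκ : κ.IsCyclotomic) {γ : absoluteGaloisGroup ℚ}
    (hγ : κ.IsTopGenerator γ) (v : HeightOneSpectrum (𝓞 ℚ)) (hv : (2 : 𝓞 ℚ) ∈ v.asIdeal)
    (g : absoluteGaloisGroup (v.adicCompletion ℚ)) (c : ℕ → localPoints W (v.adicCompletion ℚ))
    [Finite (endInvariants (conjSharpFlatSelmerInfty W κ (closureEmb (K := ℚ) (v.adicCompletion ℚ))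
      (W.frobeniusTrace 2) g c .flat γ + 1))] :
    ∃ J₀ : ℕ, ∀ J : ℕ, J₀ ≤ J →
      Nat.card (endInvariants (conjSharpFlatSelmerInfty W κ (closureEmb (K := ℚ) (v.adicCompletion ℚ))
        (W.frobeniusTrace 2) g c .flat γ + 1)) =
      Nat.card (SelmerStructure.selmerGroup (ρ := W.twistedTorsionGaloisModule 2 κ J (-1) OddBlindTwist.two_dvd_neg_one_sub_one)
        (fun pl ↦ match pl with
          | Sum.inl w => (W.twistedTorsionToLocalH1 2 κ J (-1) OddBlindTwist.two_dvd_neg_one_sub_one w.Completion).ker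
          | Sum.inr v' => W.twistedSharpFlatLocalFamily 2 κ J (-1) OddBlindTwist.two_dvd_neg_one_sub_one v
              (localTowerPointsOfEmb κ (closureEmb (K := ℚ) (v.adicCompletion ℚ)) W)
              (colemanKer κ (closureEmb (K := ℚ) (v.adicCompletion ℚ)) W (W.frobeniusTrace 2) g c .flat) v')) := by
  have _hκ := hκ -- carried to match hand h3's binders: the statement holds for any `ℤ₂`-extension `κ`
  have _hv := hv -- carried to match hand h3's binders: the statement holds at any distinguished place `v`
  exact exists_natCard_endInvariants_eq_natCard_selmerGroup_of_finite W 2 κ v (W.frobeniusTrace 2) g c .flat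
    two_dvd_neg_one_sub_one _ (fun _ _ ↦ rfl) (fun _ _ ↦ rfl)
    (fun P hP ↦ SignedTransportAtTwo.eq_zero_of_two_nsmul_eq_zero_of_goodSS W hss P (by convert hP)) hγ

end Two

end OddBlindTwist

end Summit.BirchSwinnertonDyer.BirchSwinnertonDyer.Theorems

end
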